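import Literature.AlgebraicGeometry.Resolution.LogChartSharpReduction
import Literature.AlgebraicGeometry.Resolution.LogRegularPolynomialBase
import HarnessLib

/-!
# From Kato's log regularity at a point to the refinement theorems (interface with the fan data)

`Literature/AlgebraicGeometry/Resolution/LogChartEmbeddedReduction.lean`. K. Kato, *Toric
singularities*, Amer. J. Math. 116 (1994), (10.3)/(10.4): the last step of the local analysis
reduces a chart `φ : P → A` (`P ⊆ ℤⁿ` fs), log regular at `𝔭` (`LogChart.IsLogRegularAt`), to
the "d-form" hypotheses of the `LogRegularRefinement*` files over `A_𝔭`, GIVEN an integral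
embedding `e : ℤⁿ → ℤ^M` of the sharp quotient (`e(F) = 0`, `e(P) ⊆ ℕ^M`, `e p = e p′` on `P`
only modulo `F^{gp}`) — the embedding is supplied by the regular cone of the subdivision
(Kato (9.8), (10.4): `P̄ ⊆ ℕ^r`), i.e. by the fan-theoretic part of the proof, and is an INPUT here.

* `DFormData` — the bundle of hypotheses of the refinement theorems (a chart `φ′ : ℕ^{(M)} ⊇ P′ → A`
  with `φ′(P′ ∖ 0)`, `t₁..t_d` generating `𝔪_A` and `rank P′ + d ≤ dim A`);
* `IsSharpEmbedding` — the requirements on `e`;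
* `embMonoid`, `embChart` — `P′ = e(P) ⊆ ℕ^M` and the chart `φ′(e p) = φ̄(π p)`;
* `exists_dformData_of_isLogRegularAt` — **log regular at `𝔭` + sharp embedding (+ the rank
  bound) ⇒ d-form data over `A_𝔭`**, with `φ′(e p) = φ(p)·(unit)`.

References: [Kato1994] K. Kato, Toric singularities, Amer. J. Math. 116 (1994), Def. (2.1), (3.2), (9.8), (10.3), (10.4).
-/

noncomputable section

open IsLocalRing Literature.RingTheory.MvPowerSeries

namespace Literature.AlgebraicGeometry.Resolution

namespace LogChart

universe u

/-! ### The d-form bundle -/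

/-- **d-form chart data** on a local ring `A` (the hypotheses of the refinement theorems
`LogRegularCompleteStructure.isRegularLocalRing_localization_closedPoint_of_le` &c.): a finitely
generated `P′ ⊆ ℕ^{(M)}`, a multiplicative `φ′` with `φ′(P′ ∖ 0) ⊆ 𝔪_A`, parameters
`t₁, …, t_d ∈ 𝔪_A` with `𝔪_A = (φ′(P′ ∖ 0)) + (t)`, and `rank P′ + d ≤ dim A`. [cite: Kato1994, Def. (2.1)] -/
structure DFormData {A : Type u} [CommRing A] [IsLocalRing A] {M : ℕ}
    (P' : AddSubmonoid (Fin M →₀ ℕ)) (φ' : (Fin M →₀ ℕ) → A) (d : ℕ) (t : Fin d → A) : Prop where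
  fg : P'.FG
  map_zero : φ' 0 = 1
  map_add : ∀ a ∈ P', ∀ b ∈ P', φ' (a + b) = φ' a * φ' b
  mem_maximalIdeal : ∀ p ∈ P', p ≠ 0 → φ' p ∈ maximalIdeal A
  param_mem : ∀ k, t k ∈ maximalIdeal A
  gen : maximalIdeal A ≤ Ideal.span (φ' '' {p | p ∈ P' ∧ p ≠ 0}) ⊔ Ideal.span (Set.range t)
  rank_le : ((monoidPowerSeries.rank P' + d : ℕ) : WithBot ℕ∞) ≤ ringKrullDim A

/-! ### Sharp embeddings -/

variable {n M : ℕ}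

/-- **A sharp embedding** of the chart monoid at the face `F`: an additive `e : ℤⁿ → ℤ^M`
killing `F`, non-negative on `P`, and injective on `P` modulo `F^{gp}` (such `e` exist because
`P_F/F^{gp}` is a sharp fs monoid; in Kato (10.4) it is the regular cone `ℕ^r ⊇ P̄`).
[cite: Kato1994, (9.8)] -/
structure IsSharpEmbedding (P F : AddSubmonoid (Fin n → ℤ)) (e : (Fin n → ℤ) →+ (Fin M → ℤ)) :
    Prop where
  map_face : ∀ f ∈ F, e f = 0
  nonneg : ∀ p ∈ P, ∀ i, 0 ≤ e p i
  inj : ∀ p ∈ P, ∀ p' ∈ P, e p = e p' → p - p' ∈ Submodule.span ℤ (F : Set (Fin n → ℤ))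

namespace IsSharpEmbedding

variable {P F : AddSubmonoid (Fin n → ℤ)} {e : (Fin n → ℤ) →+ (Fin M → ℤ)}

/-- `e` kills `F^{gp}`. [cite: Kato1994, (9.8)] -/
theorem map_span (he : IsSharpEmbedding P F e) {v : Fin n → ℤ}
    (hv : v ∈ Submodule.span ℤ (F : Set (Fin n → ℤ))) : e v = 0 := by
  obtain ⟨a, ha, b, hb, rfl⟩ := (mem_span_int_iff_exists_sub F).1 hv
  rw [map_sub, he.map_face a ha, he.map_face b hb, sub_zero]

/-- `e` factors through the splitting: `e (π v) = e v`. [cite: Kato1994, (9.8)] -/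
theorem map_proj (he : IsSharpEmbedding P F e) {π : (Fin n → ℤ) →ₗ[ℤ] (Fin n → ℤ)}
    (hπ1 : ∀ v, v - π v ∈ Submodule.span ℤ (F : Set (Fin n → ℤ))) (v : Fin n → ℤ) :
    e (π v) = e v := by
  have h := he.map_span (hπ1 v)
  rw [map_sub, sub_eq_zero] at h
  exact h.symm

/-- Equal images under `e` have equal projections. [cite: Kato1994, (9.8)] -/
theorem proj_eq_of_map_eq (he : IsSharpEmbedding P F e) {π : (Fin n → ℤ) →ₗ[ℤ] (Fin n → ℤ)}
    (hπ0 : ∀ v ∈ Submodule.span ℤ (F : Set (Fin n → ℤ)), π v = 0)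
    {p p' : Fin n → ℤ} (hp : p ∈ P) (hp' : p' ∈ P) (h : e p = e p') : π p = π p' := by
  have h1 := hπ0 _ (he.inj p hp p' hp' h)
  rw [map_sub, sub_eq_zero] at h1
  exact h1

end IsSharpEmbedding

/-! ### The embedded monoid `P′ = e(P) ⊆ ℕ^M` and its chart -/

section Emb

variable {P F : AddSubmonoid (Fin n → ℤ)} {e : (Fin n → ℤ) →+ (Fin M → ℤ)}

/-- The embedding on `P`, valued in `ℕ^{(M)}`. [cite: Kato1994, (9.8)] -/
def embHom (he : IsSharpEmbedding P F e) : P →+ (Fin M →₀ ℕ) where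
  toFun p := Finsupp.equivFunOnFinite.symm fun i => (e (p : Fin n → ℤ) i).toNat
  map_zero' := by
    ext i
    simp only [Finsupp.coe_equivFunOnFinite_symm, ZeroMemClass.coe_zero, map_zero, Pi.zero_apply,
      Int.toNat_zero, Finsupp.coe_zero]
  map_add' p q := by
    ext i
    simp only [Finsupp.coe_equivFunOnFinite_symm, AddMemClass.coe_add, map_add, Pi.add_apply,
      Finsupp.coe_add]
    exact Int.toNat_add (he.nonneg _ p.2 i) (he.nonneg _ q.2 i)

/-- Coordinates of the embedded element. [cite: Kato1994, (9.8)] -/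
theorem embHom_apply_coe (he : IsSharpEmbedding P F e) (p : P) (i : Fin M) :
    ((embHom he p i : ℕ) : ℤ) = e (p : Fin n → ℤ) i := by
  show (((e (p : Fin n → ℤ) i).toNat : ℕ) : ℤ) = _
  exact Int.toNat_of_nonneg (he.nonneg _ p.2 i)

/-- `embHom` detects `e`. [cite: Kato1994, (9.8)] -/
theorem embHom_eq_iff (he : IsSharpEmbedding P F e) {p q : P} :
    embHom he p = embHom he q ↔ e (p : Fin n → ℤ) = e (q : Fin n → ℤ) := by
  constructor
  · intro h
    funext i
    rw [← embHom_apply_coe he p i, ← embHom_apply_coe he q i, h]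
  · intro h
    ext i
    have := congrFun h i
    apply Int.ofNat.inj
    rw [Int.ofNat_eq_natCast, Int.ofNat_eq_natCast, embHom_apply_coe, embHom_apply_coe, this]

/-- **The embedded monoid** `P′ = e(P) ⊆ ℕ^{(M)}`. [cite: Kato1994, (9.8)] -/
def embMonoid (he : IsSharpEmbedding P F e) : AddSubmonoid (Fin M →₀ ℕ) :=
  (⊤ : AddSubmonoid P).map (embHom he)

/-- Membership in `P′`. [cite: Kato1994, (9.8)] -/
theorem mem_embMonoid (he : IsSharpEmbedding P F e) {w : Fin M →₀ ℕ} :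
    w ∈ embMonoid he ↔ ∃ p : P, embHom he p = w := by
  simp only [embMonoid, AddSubmonoid.mem_map, AddSubmonoid.mem_top, true_and]

/-- `P′` is finitely generated when `P` is. [cite: Kato1994, (9.8)] -/
theorem embMonoid_fg (he : IsSharpEmbedding P F e) (hP : P.FG) : (embMonoid he).FG :=
  ((AddMonoid.fg_iff_addSubmonoid_fg P).mpr hP |> AddMonoid.fg_def.mp).map _

variable {A : Type u} [CommRing A] {φ : Multiplicative P →* A} {𝔭 : Ideal A} [𝔭.IsPrime]
  {π : (Fin n → ℤ) →ₗ[ℤ] (Fin n → ℤ)}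

open Classical in
/-- **The embedded chart** `φ′ : ℕ^{(M)} → A_𝔭`: `φ′(e p) = φ̄(π p)`, and `1` off `P′`.
[cite: Kato1994, (3.2)] -/
def embChart (he : IsSharpEmbedding P (faceMonoid P φ 𝔭) e) (π : (Fin n → ℤ) →ₗ[ℤ] (Fin n → ℤ))
    (w : Fin M →₀ ℕ) : Localization.AtPrime 𝔭 :=
  if h : ∃ p : P, embHom he p = w then sharpChart P φ 𝔭 (π (h.choose : Fin n → ℤ)) else 1

/-- `φ′(e p) = φ̄(π p)`. [cite: Kato1994, (3.2)] -/
theorem embChart_embHom (he : IsSharpEmbedding P (faceMonoid P φ 𝔭) e)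
    (hπ0 : ∀ v ∈ Submodule.span ℤ (faceMonoid P φ 𝔭 : Set (Fin n → ℤ)), π v = 0) (p : P) :
    embChart he π (embHom he p) = sharpChart P φ 𝔭 (π (p : Fin n → ℤ)) := by
  classical
  have hex : ∃ q : P, embHom he q = embHom he p := ⟨p, rfl⟩
  unfold embChart
  rw [dif_pos hex]
  congr 1
  exact he.proj_eq_of_map_eq hπ0 hex.choose.2 p.2 ((embHom_eq_iff he).1 hex.choose_spec)

/-- `π p = 0` iff `e p = 0` on `P`. [cite: Kato1994, (9.8)] -/
theorem proj_eq_zero_iff_embHom_eq_zero (he : IsSharpEmbedding P (faceMonoid P φ 𝔭) e)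
    (hπ0 : ∀ v ∈ Submodule.span ℤ (faceMonoid P φ 𝔭 : Set (Fin n → ℤ)), π v = 0)
    (hπ1 : ∀ v, v - π v ∈ Submodule.span ℤ (faceMonoid P φ 𝔭 : Set (Fin n → ℤ))) (p : P) :
    π (p : Fin n → ℤ) = 0 ↔ embHom he p = 0 := by
  rw [← map_zero (embHom he), embHom_eq_iff he]
  constructor
  · intro h0
    rw [ZeroMemClass.coe_zero, map_zero, ← he.map_proj hπ1 (p : Fin n → ℤ), h0, map_zero]
  · intro h0
    have := he.proj_eq_of_map_eq hπ0 p.2 P.zero_mem (by rw [h0, ZeroMemClass.coe_zero])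
    rw [this, map_zero]

/-- **The embedded chart is in d-form** (apart from the parameters): `φ′(0) = 1`, multiplicative
on `P′`, `φ′(P′ ∖ 0) ⊆ 𝔪`, and `(φ′(P′ ∖ 0)) = I(𝔭) A_𝔭`. [cite: Kato1994, (3.2)] -/
theorem embChart_dform (he : IsSharpEmbedding P (faceMonoid P φ 𝔭) e)
    (hπ0 : ∀ v ∈ Submodule.span ℤ (faceMonoid P φ 𝔭 : Set (Fin n → ℤ)), π v = 0)
    (hπ1 : ∀ v, v - π v ∈ Submodule.span ℤ (faceMonoid P φ 𝔭 : Set (Fin n → ℤ))) :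
    embChart he π 0 = 1 ∧
    (∀ a ∈ embMonoid he, ∀ b ∈ embMonoid he,
      embChart he π (a + b) = embChart he π a * embChart he π b) ∧
    (∀ w ∈ embMonoid he, w ≠ 0 → embChart he π w ∈ maximalIdeal (Localization.AtPrime 𝔭)) ∧
    Ideal.span (embChart he π '' {w | w ∈ embMonoid he ∧ w ≠ 0}) =
      (ideal P φ 𝔭).map (algebraMap A (Localization.AtPrime 𝔭)) := by
  have hface := isFaceOf_faceMonoid P φ 𝔭
  refine ⟨?_, ?_, ?_, ?_⟩
  · rw [← map_zero (embHom he), embChart_embHom he hπ0, ZeroMemClass.coe_zero, map_zero, sharpChart_zero]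
  · intro a ha b hb
    obtain ⟨p, rfl⟩ := (mem_embMonoid he).1 ha
    obtain ⟨q, rfl⟩ := (mem_embMonoid he).1 hb
    rw [← map_add, embChart_embHom he hπ0, embChart_embHom he hπ0, embChart_embHom he hπ0,
      AddMemClass.coe_add, map_add]
    exact sharpChart_proj_add hπ1 p.2 q.2
  · intro w hw hw0
    obtain ⟨p, rfl⟩ := (mem_embMonoid he).1 hw
    rw [embChart_embHom he hπ0]
    refine sharpChart_proj_mem_maximalIdeal hπ0 hπ1 p.2 fun h0 => hw0 ?_
    exact (proj_eq_zero_iff_embHom_eq_zero he hπ0 hπ1 p).1 h0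
  · rw [← span_sharpChart_eq hπ0 hπ1 hface]
    congr 1
    ext x
    constructor
    · rintro ⟨w, ⟨hw, hw0⟩, rfl⟩
      obtain ⟨p, rfl⟩ := (mem_embMonoid he).1 hw
      refine ⟨π (p : Fin n → ℤ), ⟨⟨(p : Fin n → ℤ), p.2, rfl⟩, fun h0 => hw0 ?_⟩, ?_⟩
      · exact (proj_eq_zero_iff_embHom_eq_zero he hπ0 hπ1 p).1 h0
      · rw [embChart_embHom he hπ0]
    · rintro ⟨_, ⟨⟨p, hp, rfl⟩, hp0⟩, rfl⟩
      refine ⟨embHom he ⟨p, hp⟩, ⟨(mem_embMonoid he).2 ⟨_, rfl⟩, fun h0 => hp0 ?_⟩, ?_⟩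
      · exact (proj_eq_zero_iff_embHom_eq_zero he hπ0 hπ1 ⟨p, hp⟩).2 h0
      · rw [embChart_embHom he hπ0]; rfl

/-- **Compatibility with the original chart**: `φ′(e p) · (unit) = φ(p)` in `A_𝔭`.
[cite: Kato1994, (3.2)] -/
theorem exists_embChart_embHom_mul_eq (he : IsSharpEmbedding P (faceMonoid P φ 𝔭) e)
    (hπ0 : ∀ v ∈ Submodule.span ℤ (faceMonoid P φ 𝔭 : Set (Fin n → ℤ)), π v = 0)
    (hπ1 : ∀ v, v - π v ∈ Submodule.span ℤ (faceMonoid P φ 𝔭 : Set (Fin n → ℤ))) (p : P) :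
    ∃ v : (Localization.AtPrime 𝔭)ˣ,
      embChart he π (embHom he p) * ↑v = algebraMap A (Localization.AtPrime 𝔭) (val P φ (p : Fin n → ℤ)) := by
  obtain ⟨f₁, hf₁, f₂, hf₂, h1⟩ := exists_presentation_proj (P := P) (φ := φ) (𝔭 := 𝔭) hπ1 (p : Fin n → ℤ)
  have hmul := sharpChart_mul_of_eq_sub P φ 𝔭 (P.add_mem p.2 hf₂.1) hf₁ h1
  have hu₁ := isUnit_algebraMap_val P φ 𝔭 hf₁
  have hu₂ := isUnit_algebraMap_val P φ 𝔭 hf₂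
  refine ⟨hu₁.unit * hu₂.unit⁻¹, ?_⟩
  rw [embChart_embHom he hπ0, Units.val_mul, ← mul_assoc, IsUnit.unit_spec, hmul,
    val_add P φ p.2 hf₂.1, map_mul, mul_assoc, IsUnit.mul_val_inv, mul_one]

end Emb

/-! ### Assembly: log regular at `𝔭` ⇒ d-form data over `A_𝔭` -/

/-- **Log regularity in d-form over `A_𝔭`.** Let `φ : P → A` be a chart by a finitely generated
saturated `P ⊆ ℤⁿ`, log regular at the prime `𝔭` (Kato (2.1)), and `e : ℤⁿ → ℤ^M` a sharp
embedding at the face `F_𝔭` whose image monoid has `rank ≤ n − rk F_𝔭^{gp}`. Then the embedded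
chart `φ′` together with lifted regular parameters `t` is d-form chart data on `A_𝔭`, and
`φ′(e p)` differs from `φ(p)` by a unit. [cite: Kato1994, Def. (2.1)] -/
theorem exists_dformData_of_isLogRegularAt {A : Type u} [CommRing A]
    {P : AddSubmonoid (Fin n → ℤ)} (hP : P.FG)
    (hsat : ∀ (v : Fin n → ℤ) (k : ℕ), 0 < k → k • v ∈ P → v ∈ P)
    {φ : Multiplicative P →* A} {𝔭 : Ideal A} [𝔭.IsPrime] (hreg : IsLogRegularAt P φ 𝔭)
    {e : (Fin n → ℤ) →+ (Fin M → ℤ)} (he : IsSharpEmbedding P (faceMonoid P φ 𝔭) e)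
    (hrank : monoidPowerSeries.rank (embMonoid he) ≤
      n - Module.finrank ℤ (Submodule.span ℤ (faceMonoid P φ 𝔭 : Set (Fin n → ℤ)))) :
    ∃ (π : (Fin n → ℤ) →ₗ[ℤ] (Fin n → ℤ)) (d : ℕ) (t : Fin d → Localization.AtPrime 𝔭),
      DFormData (embMonoid he) (embChart he π) d t ∧
      ∀ p : P, ∃ v : (Localization.AtPrime 𝔭)ˣ,
        embChart he π (embHom he p) * ↑v =
          algebraMap A (Localization.AtPrime 𝔭) (val P φ (p : Fin n → ℤ)) := by
  have hface := isFaceOf_faceMonoid P φ 𝔭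
  obtain ⟨π, hπ0, hπ1, -⟩ := hface.exists_proj hsat
  obtain ⟨d, t, ht, hgen, hdim⟩ := exists_dform_of_isLogRegularAt P φ 𝔭 hreg
  obtain ⟨h0, hadd, hmax, hspan⟩ := embChart_dform he hπ0 hπ1
  refine ⟨π, d, t, ⟨embMonoid_fg he hP, h0, hadd, hmax, ht, ?_, ?_⟩,
    fun p => exists_embChart_embHom_mul_eq he hπ0 hπ1 p⟩
  · rw [hspan]; exact hgen
  · rw [hdim]
    have h := Nat.add_le_add_right hrank d
    rw [Nat.add_comm (n - _) d] at h
    exact_mod_cast h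

end LogChart

end Literature.AlgebraicGeometry.Resolution
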